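import Summits.BirchSwinnertonDyer.Rank1Residual.Additive.X4ThreeKuriharaCertKernel
import Summits.BirchSwinnertonDyer.Rank1Residual.EisensteinPrimes
import HarnessLib

/-!
# The sign of `ord_p j(E)` READ OFF AN INTEGER MODEL: the potentially-multiplicative / potentially-good
# bit of a row as a `decide` certificate (cell `b2b-bsdres`, team n1011, seat p03, OWNERS row T-a2-REC;
# kernel-node tool, sequel of `X4ThreeKuriharaCertKernel.lean`)

HONEST FRAMING (cell `b2b-bsdres`, run/shared/lean/b2b/bsd-rank1-residual/, verbatim in every
file): the goal of the cell is to DELETE the COMBINATION-SHAPED residual classes of the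
Birch–Swinnerton-Dyer formula for ALL analytic-rank `≤ 1` elliptic curves over `ℚ` — "full BSD
formula for every rank `≤ 1` curve in class `C`" assembled STRICTLY from published theorems — so
that the rank-`≤ 1` remainder becomes exactly the CONSTRUCTION-SHAPED classes, which are TYPED
(missing-input `Prop`s), NOT attempted. This is not "finishing BSD". Team n1011 is a RESEARCH ROUTE;
no claim beyond the stated classes; labels and RESIDUAL-MAP marks UNCHANGED; nothing is booked. This
file is a DATA-FREE kernel tool (valuations of `j = c₄³/Δ` on the minimal model); no named fact, no
definition, no new `Prop`.

## What this file proves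

Many per-pair theorems of the cell branch on the sign of `ord_p j(E)`: the Tamagawa-defect record
shape of T-a2-REC (`X4RankZero.bsdp_three_of_optimal_of_kuriharaIndexLeAt_of_cov`, its `_towerSurj_`
and `_noL20` twins) takes `hcov : ord₃ j < 0 ∨ …`; the (M)-branch / potentially-good-branch theorems of
p01 / p06 / p12 / additive-p1 take `padicValRat p W.j < 0` resp. `0 ≤ padicValRat p W.j`
(`…_of_padicValRat_j_nonneg`); the census carries the same bit as `pot_mult`.  On a globally minimal
`W` with integer model `E₀` (`integralModelInt W = E₀`) the bit is two integer divisibilities, so a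
record discharges it by `decide` on Cremona's coefficients:

* `padicValRat_j_eq_of_intModel` — `ord_p j = 3·ord_p c₄(E₀) − ord_p Δ(E₀)` whenever `c₄(E₀) ≠ 0`
  (any prime `p`; no reduction hypothesis — the good-reduction special case `ord_p Δ = 0` is
  `EisensteinPrimes.padicValRat_j_eq_of_good`);
* `padicValRat_j_neg_of_intModel` — certificate `a : ℕ` with `p^(a+1) ∤ c₄(E₀)` and `p^(3a+1) ∣ Δ(E₀)`
  ⟹ `ord_p j < 0` (POTENTIALLY MULTIPLICATIVE at an additive `p`; the `hcov` left disjunct);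
* `padicValRat_j_nonneg_of_intModel` — certificate `a : ℕ` with `p^a ∣ c₄(E₀)` and `p^(3a+1) ∤ Δ(E₀)`
  ⟹ `0 ≤ ord_p j` (POTENTIALLY GOOD); and `j_eq_zero_of_intModel` — `c₄(E₀) = 0` ⟹ `j = 0`.

References: J. H. Silverman, *The Arithmetic of Elliptic Curves*, 2nd ed., GTM 106 (2009), III.1
(`j = c₄³/Δ`), VII.5 Prop. 5.1 and Prop. 5.5 (potentially good ⟺ `j` integral) [SilvermanAEC2009];
cell files cells/n1011/skel/T-a2-REC.md §5 (kernel-node column), cells/n1011/PREDICTIONS-E2-AT3.md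
(covariate `pot_mult`).
-/

noncomputable section

open scoped Classical

open WeierstrassCurve
  Summit.BirchSwinnertonDyer.BirchSwinnertonDyer.Rank1Residual.IntModel
  Summit.BirchSwinnertonDyer.Rank1Residual.EisensteinPrimes

namespace Summit.BirchSwinnertonDyer.Rank1Residual.Additive

section JVal

variable {W : WeierstrassCurve ℚ} [W.IsElliptic] [W.IsGloballyMinimal] {E₀ : WeierstrassCurve ℤ}
  (hI : integralModelInt W = E₀) (p : ℕ) [hp : Fact p.Prime]
include hI

/-- **`ord_p j(E) = 3·ord_p c₄(E₀) − ord_p Δ(E₀)`** on the minimal model (`j = c₄³/Δ`, `c₄ ≠ 0`; any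
prime `p`). [cite: SilvermanAEC2009, III.1 (definition of j) and VII.1] -/
theorem padicValRat_j_eq_of_intModel (hc : E₀.c₄ ≠ 0) :
    padicValRat p W.j = 3 * (padicValInt p E₀.c₄ : ℤ) - padicValInt p E₀.Δ := by
  have hΔ0 : E₀.Δ ≠ 0 := by rw [← minimalDiscriminantInt_eq hI]; exact minimalDiscriminantInt_ne_zero W
  rw [j_eq_intModel W, hI, padicValRat.div (pow_ne_zero _ (by exact_mod_cast hc)) (by exact_mod_cast hΔ0),
    padicValRat.pow, padicValRat.of_int, padicValRat.of_int]
  push_cast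
  ring

/-- **`c₄(E₀) = 0 ⟹ j(E) = 0`** (then `E` is potentially good at every prime). [cite: SilvermanAEC2009, III.1] -/
theorem j_eq_zero_of_intModel (hc : E₀.c₄ = 0) : W.j = 0 := by
  rw [j_eq_intModel W, hI, hc]
  simp

/-- **POTENTIALLY MULTIPLICATIVE bit from the model**: a certificate `a` with `p^(a+1) ∤ c₄(E₀)`
(`ord_p c₄ ≤ a`) and `p^(3a+1) ∣ Δ(E₀)` (`ord_p Δ ≥ 3a + 1`) gives `ord_p j(E) < 0` — the left disjunct of
the `hcov` binder of the Tamagawa-defect record shape, and `PotMult W p`, by `decide` on the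
coefficients. [cite: SilvermanAEC2009, VII.5 Prop. 5.1 (b) and Prop. 5.5] -/
theorem padicValRat_j_neg_of_intModel (a : ℕ) (hc : ¬ (p : ℤ) ^ (a + 1) ∣ E₀.c₄)
    (hΔ : (p : ℤ) ^ (3 * a + 1) ∣ E₀.Δ) : padicValRat p W.j < 0 := by
  have hc0 : E₀.c₄ ≠ 0 := fun h => hc (h ▸ dvd_zero _)
  have hΔ0 : E₀.Δ ≠ 0 := by rw [← minimalDiscriminantInt_eq hI]; exact minimalDiscriminantInt_ne_zero W
  have hvc : padicValInt p E₀.c₄ ≤ a := by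
    by_contra h
    exact hc ((padicValInt_dvd_iff (a + 1) E₀.c₄).mpr (Or.inr (by omega)))
  have hvΔ : 3 * a + 1 ≤ padicValInt p E₀.Δ := by
    rcases (padicValInt_dvd_iff (3 * a + 1) E₀.Δ).mp hΔ with h | h
    · exact absurd h hΔ0
    · exact h
  rw [padicValRat_j_eq_of_intModel hI p hc0]
  omega

/-- **POTENTIALLY GOOD bit from the model**: a certificate `a` with `p^a ∣ c₄(E₀)` (`ord_p c₄ ≥ a`, or
`c₄ = 0`) and `p^(3a+1) ∤ Δ(E₀)` (`ord_p Δ ≤ 3a`) gives `0 ≤ ord_p j(E)` — the hypothesis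
`padicValRat_j_nonneg` of the potentially-good-branch theorems, by `decide` on the coefficients.
[cite: SilvermanAEC2009, VII.5 Prop. 5.5] -/
theorem padicValRat_j_nonneg_of_intModel (a : ℕ) (hc : (p : ℤ) ^ a ∣ E₀.c₄)
    (hΔ : ¬ (p : ℤ) ^ (3 * a + 1) ∣ E₀.Δ) : 0 ≤ padicValRat p W.j := by
  by_cases hc0 : E₀.c₄ = 0
  · rw [j_eq_zero_of_intModel hI hc0]; simp
  have hvc : a ≤ padicValInt p E₀.c₄ := by
    rcases (padicValInt_dvd_iff a E₀.c₄).mp hc with h | h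
    · exact absurd h hc0
    · exact h
  have hvΔ : padicValInt p E₀.Δ ≤ 3 * a := by
    by_contra h
    exact hΔ ((padicValInt_dvd_iff (3 * a + 1) E₀.Δ).mpr (Or.inr (by omega)))
  rw [padicValRat_j_eq_of_intModel hI p hc0]
  omega

end JVal

end Summit.BirchSwinnertonDyer.Rank1Residual.Additive

end
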